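import Literature.NumberTheory.Automorphic.BaseChangeStrongCuspidalPrime
import Literature.NumberTheory.Automorphic.ReciprocityGLnUniquenessHolds
import Literature.NumberTheory.Automorphic.VarmaUnramifiedWeilTracesProofs
import HarnessLib

/-!
# Varma 2024, Cor. 9.3 (and Thm. 1 at the unramified places) from Thm. 9.2 by quadratic base
# change: the printed deduction "Thm. 9.2 + Lemma 1 of [So], as in HT Thm. VII.1.9", proved

Topic `Literature/NumberTheory/Automorphic`; a PROOFS file (theorems only: no definition, no named
fact, no instance — D-0014/D-0026), sibling of `ReciprocityGLnExistenceProofs` (which formalises the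
same printed argument for Harris–Lan–Taylor–Thorne's Cor. 7.14 from Thm. 7.13) and of
`VarmaUnramifiedWeilTracesProofs`.

## The source, read

I. Varma, *Local–global compatibility for regular algebraic cuspidal automorphic representations
when `ℓ ≠ p`*, Forum Math. Sigma 12 (2024) e21 (journal PDF read, pp. 4, 30–32; = arXiv:1411.2520,
where the numbering is Thm. 10.2 / Cor. 10.3 and the standing hypotheses differ slightly):

* **Notation and conventions (p. 4):** "Let `F⁺` be a totally real field, and let `F₀` denote an
  imaginary quadratic field. We set `F = F₀F⁺` … Let `p` denote a rational prime that splits in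
  `F₀`. Let `n` denote a positive integer, and if `F⁺ = ℚ`, assume `n > 2`. In the sequel, `ℓ` will
  always denote a rational prime such that `ℓ ≠ p`. Fix `ı : ℚ̄_p ≅ ℂ`."
* **Theorem 9.2 (pp. 30–31):** "Suppose that `π` is a cuspidal automorphic representation of
  `GL_n(𝔸_F)` such that `π_∞` has the same infinitesimal character as an algebraic representation
  of `RS^F_ℚ GL_n`. Then there is a continuous semisimple representation
  `r_{p,ı}(π) : G_F → GL_n(ℚ̄_p)` such that if `v ∤ p` is a prime of `F` above a rational prime `ℓ`
  satisfying either (1) `ℓ` is split over `F₀`, or (2) `π` and `F` are unramified at all primes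
  above `ℓ`, then `WD(r_{p,ı}(π)|_{G_{F_v}})^{Frob-ss} ≺ ı⁻¹ rec_{F_v}(π_v |det|^{(1-n)/2})`. In
  particular, if `π` and `F` are unramified at `v`, then `r_{p,ı}(π)` is unramified [at `v`]."
  Its proof ("Assume that `n > 1` …") first establishes (9.1)
  `(r_{p,ı}(π)|_{W_{F_v}})^{ss} ≅ ı⁻¹rec_{F_v}(π_v|det|_v^{(1-n)/2})^{ss}` at these `v`.
* **Corollary 9.3 (p. 32):** "Suppose that `E` is a totally real or CM field and that `π` is a
  cuspidal automorphic representation such that `π_∞` has the same infinitesimal character as an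
  algebraic representation of `RS^E_ℚ GL_n`. Then there is a continuous semisimple representation
  `r_{p,ı} : G_E → GL_n(ℚ̄_p)` such that, if `ℓ ≠ p` is a prime and if `v ∣ ℓ` is a prime of `E`,
  then `WD(r_{p,ı}(π)|_{W_{E_v}})^{Frob-ss} ≺ ı⁻¹rec_{E_v}(π_v|det|_v^{(1-n)/2})`.  *Proof.* This can
  be deduced from Theorem 9.2 in conjunction with Lemma 1 of [21] [Sorensen, *A patching lemma*]
  using the same argument as in Theorem VII.1.9 of [11] [Harris–Taylor]."

## What this file proves

The printed deduction of Cor. 9.3 from Thm. 9.2, in the tree's unramified-place vocabulary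
(`IsGaloisCompatibleAt`: `r` unramified at `v` with arithmetic-Frobenius characteristic polynomial
`arithFrobPolyOfSatake ı q_v n α_v` — which is what `≺` together with (9.1) say at a place where
`π_v` is unramified, see `Varma2024.corollary93_unramified`), from Thm. 9.2 taken as a **raw
hypothesis `h92`** spelled out in the shape of the tree's rendering of Harris–Lan–Taylor–Thorne's
Thm. 7.13 (`HarrisLanTaylorThorne2016.theorem713_of_leaves`: `K` CM with an imaginary quadratic
subfield `F₀` in which `p` splits; conclusion at the places over the rational primes `q ≠ p` of the
two printed alternatives — for Varma the first alternative "`q` split in `F₀`" carries **no**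
unramifiedness of `π` above `q`, which is exactly what Cor. 9.3 needs), and from the two
Arthur–Clozel leaves already used by the tree's proof of HLTT's Cor. 7.14
(`ArthurClozel1989_strongLifting_archimedean`, `ArthurClozel1989_strongLifting_cuspidal`).  No new
named fact is introduced here (the statement of Thm. 9.2 is vendored separately, in its own file).

* `Varma2024.compatibleAE_restrictField_of_isCompatible` — an HLTT-compatible `r : Γ_K → GL_n` is,
  after restriction to any number field `L ⊇ K`, compatible almost everywhere with the Frobenius
  datum of `π` (`PatchingFamily.CompatibleAE`).
* `Varma2024.exists_rep_member_of_theorem92` — **the representation of a member** `K_D = K(√-D)`,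
  `D ∈ GoodPrime K (8ℓ) B`: the strong base change `π_D` (cuspidal, regular algebraic) and Thm. 9.2
  over the CM field `K_D ⊇ ℚ(√-D)` give `ρ_D` semisimple, compatible almost everywhere with the datum
  of `π` (second alternative, at the cofinitely many good places) and compatible with `π_D` at
  **every** place of `K_D` over a rational prime `q ≠ ℓ` with `8q ∣ D + 1` (first alternative: `q`
  splits in `ℚ(√-D)`; no condition on `π` above `q`).  Verbatim the tree's `exists_rep_member` with
  Thm. 9.2 in place of Thm. 7.13.
* `Varma2024.corollary93_unramified_rank_zero`, `…_rank_one` — the degenerate rank `0` and Weil's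
  rank one (`theoremA_existence_rank_one`'s character is compatible at every `v ∤ ℓ`; any other
  HLTT-compatible `r` is isomorphic to it, `theoremA_uniqueness_holds`), unconditionally.
* `Varma2024.corollary93_unramified_of_theorem92` — **Cor. 9.3 (unramified places) from Thm. 9.2
  and the Arthur–Clozel leaves**: given `r` semisimple and HLTT-compatible and a place `v ∤ ℓ` over
  `q` at which `π` is unramified, either `π` is unramified above `q` (then HLTT-compatibility
  answers), or `K` has two places over `q`, so `[K:ℚ] ≥ 2` and the members `K_D` are not imaginary
  quadratic ("if `F⁺ = ℚ`, assume `n > 2`" is then void); take a member with `8q ∣ D + 1` in which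
  `v` splits completely (`GoodPrime.exists_dvd_split`), identify `r|_{Γ_{K_D}} ≅ ρ_D` (both
  compatible a.e. with the datum of `π`: Chebotarev + Brauer–Nesbitt, `CompatibleAE.nonempty_equiv`,
  Chebotarev being the discharged `chebotarev_artinRep_holds`), transport the compatibility of `ρ_D`
  at the places over `v` (`IsGaloisCompatibleAt.of_equiv`) and descend it to `K`
  (`isGaloisCompatibleAt_of_restrictField`: `e = f = 1`).  This is Harris–Taylor's argument
  (pp. 229–232) with the given `r` in place of the patched one — since `r` is given, Sorensen's
  lemma itself is not even needed, only its uniqueness half.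
* `Varma2024.theorem1_unramified_traces_of_theorem92` — with
  `theorem1_unramified_traces_of_corollary93_unramified` (`VarmaUnramifiedWeilTracesProofs`).
* `Varma2024.theorem1_unramified_traces_of_regularAlgebraic` — library-first form: the trace
  fact from **lang.S27** (`exists_galoisRep_of_regularAlgebraic`) alone, through the proved
  uniqueness clause of Thm. A (`corollary93_unramified_of_regularAlgebraic`,
  `ReciprocityGLnUniquenessHolds`) and `theorem1_unramified_traces_of_corollary93_unramified`.
* `exists_galoisRep_of_regularAlgebraic_of_theorem92` — **lang.S27** from HLTT Cor. 6.27, the two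
  Arthur–Clozel leaves and Thm. 9.2 (`exists_galoisRep_of_regularAlgebraic_of_namedLeaves` with
  Cor. 9.3 now derived).

## References

* I. Varma, Forum Math. Sigma 12 (2024) e21, doi:10.1017/fms.2024.7: Notation (p. 4), Thm. 9.2
  (pp. 30–31) with (9.1), Cor. 9.3 (p. 32); arXiv:1411.2520v1: §2 (p. 5), Thm. 10.2, Cor. 10.3
  (p. 24). [VarmaFMS2024]
* M. Harris, R. Taylor, *The geometry and cohomology of some simple Shimura varieties*, Ann. of
  Math. Stud. 151 (2001), proof of Thm. VII.1.9 (pp. 229–232). [HarrisTaylorAMS2001]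
* C. M. Sorensen, *A patching lemma*, in *Shimura Varieties*, LMS Lecture Note Ser. 457 (2020), §1
  Lemma 1–2. [Sorensen2020]
* J. Arthur, L. Clozel, Ann. of Math. Stud. 120 (1989), Ch. 3, Thm. 4.2 (a), Thm. 5.1, (1.1).
  [ArthurClozelAMS120]
* M. Harris, K.-W. Lan, R. Taylor, J. Thorne, Res. Math. Sci. 3:37 (2016), Thm. A (p. 3),
  Thm. 7.13 and Cor. 7.14 (p. 232). [HarrisLanTaylorThorneRMS2016]
-/

noncomputable section

open scoped MatrixGroups Matrix Classical Polynomial NumberField IntermediateField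
open NumberField IsDedekindDomain Field Polynomial Filter
open Literature.NumberTheory.GaloisRepresentations
open Literature.NumberTheory.GaloisRepresentations.QuadraticFamily
open Literature.NumberTheory.Automorphic.PatchingFamily
open Literature.NumberTheory.Automorphic.HarrisLanTaylorThorne2016

namespace Literature.NumberTheory.Automorphic

namespace Varma2024

variable {n : ℕ} {K : Type} [Field K] [NumberField K] {hcpt : isCompact_glFiniteIntegralLevel n K}
  {ℓ : ℕ} [Fact ℓ.Prime]

/-! ### §1. HLTT-compatibility restricted to an extension is compatibility almost everywhere -/

/-- **An HLTT-compatible representation is compatible almost everywhere with the Frobenius datum of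
`π`, after restriction to any finite extension `L ⊇ K`.**  Let `E` be a Frobenius datum of `π`
(`∏_{a ∈ E v}(X - a) = arithFrobPolyOfSatake ı q_v n α_v`) and `r : Γ_K → GL_n(ℚ̄_ℓ)` with
Harris–Lan–Taylor–Thorne's property (`IsCompatible π ı r`).  All but finitely many places `v` of `K`
lie over a rational prime `q ≠ ℓ` above which `π` is unramified (`finite_setOf_not_exists_goodPrime`,
Flath's `hasSatakeParamAt_cofinite_holds`), hence so do all but finitely many places `w` of `L`
(`eventually_under`); there `r` is unramified with characteristic polynomial `∏_{a ∈ E v}(X - a)`, so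
`r|_{Γ_L}` is unramified at `w` with characteristic polynomial `∏ (X - a^{f(w|v)}) = frobPoly E v f`
(`FramedGaloisRep.hasFrobCharpolyAt_restrictField`).  [folklore] -/
theorem compatibleAE_restrictField_of_isCompatible {L : Type} [Field L] [NumberField L]
    [Algebra K L] (π : AutomorphicRepData (AutomorphyDatum.gl n K hcpt)) (ι : PadicAlgCl ℓ ≃+* ℂ)
    (r : FramedGaloisRep K (PadicAlgCl ℓ) n) (hc : IsCompatible π ι r)
    (E : HeightOneSpectrum (𝓞 K) → Multiset (PadicAlgCl ℓ))
    (hE : ∀ (v : HeightOneSpectrum (𝓞 K)) (α : Multiset ℂ), π.HasSatakeParamAt v α →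
      ((E v).map fun a ↦ X - C a).prod = arithFrobPolyOfSatake ι v.residueCard n α) :
    CompatibleAE E (r.restrictField L) := by
  have hℓ : ℓ.Prime := Fact.out
  have hgood := (finite_setOf_not_exists_goodPrime π π.hasSatakeParamAt_cofinite_holds ℓ
    hℓ).compl_mem_cofinite
  show ∀ᶠ w : HeightOneSpectrum (𝓞 L) in cofinite, _
  filter_upwards [eventually_under (E := L) hgood] with w hw
  have hw' := hw (w.under (𝓞 K)) rfl
  simp only [not_not] at hw'
  obtain ⟨q, hq, hqℓ, -, hπq, hqv⟩ := hw'
  obtain ⟨α, hα⟩ := hπq _ hqv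
  obtain ⟨hunr, hch⟩ := hc q hq hqℓ hπq _ hqv α hα
  have hwv : w.asIdeal.under (𝓞 K) = (w.under (𝓞 K)).asIdeal := rfl
  refine ⟨r.isUnramifiedAt_restrictField hwv hunr, ?_⟩
  rw [← hE _ α hα] at hch
  exact r.hasFrobCharpolyAt_restrictField hwv hunr hch

/-! ### §2. The representation of a member, from Thm. 9.2 -/

/-- **The representation of a member of the family `K(√-D)`, from Varma's Thm. 9.2** (the analogue
of `HarrisLanTaylorThorne2016.exists_rep_member`, with Thm. 9.2 — raw hypothesis `h92`, in the shape
of `theorem713_of_leaves` but with the first alternative "`q` splits in `F₀`" free of any condition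
on `π` above `q` — in place of Thm. 7.13).  Let `K` be totally real or CM, `π` cuspidal regular
algebraic on `GL_n(𝔸_K)`, `n ≥ 2`, `[K : ℚ] ≥ 2` unless `n > 2` (Varma's "if `F⁺ = ℚ`, assume
`n > 2`" for the member `K(√-D)`, which is imaginary quadratic exactly when `K = ℚ`), `E` a Frobenius
datum of `π`, and `B` a set of rational primes containing every prime below a place of `K` ramified
over `ℤ` or a ramified place of `π`.  For `D ∈ GoodPrime K (8ℓ) B`: the strong base change `π_D` of
`π` to `K_D = K(√-D)` (`hBC`, at the ramified place above `D` where `π` is unramified) is cuspidal and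
regular algebraic (`harch`); `K_D` is CM and contains `F₀ = ℚ(√-D)`, imaginary quadratic, in which
`ℓ` and every `q` with `8q ∣ D + 1` split (`exists_intermediateField_hasTwoPrimesOver`); Thm. 9.2
gives `ρ = r_{ℓ,ı}(π_D)`, semisimple, with: **(i)** `ρ` compatible almost everywhere with `E` (second
alternative at the cofinitely many places over a rational `q ≠ ℓ` unramified in `K_D` above which
`π_D` is unramified, `finite_setOf_not_exists_goodPrime`, and the strong relation
`t_{π_D,w} = t_{π,v}^{f}`, `arithFrobPolyOfSatake_pow`); **(ii)** for every rational prime `q ≠ ℓ`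
with `8q ∣ D + 1` and every place `w` of `K_D` over `q`, `ρ` is compatible with `π_D` at `w` (first
alternative), and `π_D` has the Satake parameter `α_v` of `π` at every `w` over a place `v ∣ q` at
which `π` is unramified (`v` splits completely in `K_D`, `ncard_primesOver_sqrtNegField_eq_two`, so
`f(w|v) = 1`).  [cite: VarmaFMS2024, Thm. 9.2 (pp. 30–31) and proof of Cor. 9.3 (p. 32)]
[cite: HarrisTaylorAMS2001, proof of Thm. VII.1.9 (pp. 229–231)] -/
theorem exists_rep_member_of_theorem92
    (h92 : ∀ {n : ℕ} {K : Type} [Field K] [NumberField K]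
      (hcpt : isCompact_glFiniteIntegralLevel n K) (p : ℕ) [Fact p.Prime], 1 < n → IsCMField K →
      ∀ (F₀ : IntermediateField ℚ K), Module.finrank ℚ F₀ = 2 ∧ IsTotallyComplex F₀ →
      HasTwoPrimesOver F₀ p → (Module.finrank ℚ K = 2 → 2 < n) →
      ∀ (π : CuspidalAutomorphicRepData n K hcpt), π.1.IsRegularAlgebraic →
      ∀ (ι : PadicAlgCl p ≃+* ℂ),
      ∃ r : FramedGaloisRep K (PadicAlgCl p) n, r.toGaloisRep.IsSemisimple ∧
        ∀ q : ℕ, q.Prime → q ≠ p →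
          (HasTwoPrimesOver F₀ q ∨
            (Algebra.IsUnramifiedIn (𝓞 K) (Ideal.span {(q : ℤ)}) ∧ π.1.IsUnramifiedAbove q)) →
          ∀ v : HeightOneSpectrum (𝓞 K), ((q : ℕ) : 𝓞 K) ∈ v.asIdeal →
            IsGaloisCompatibleAt π.1 ι r v)
    (harch : ArthurClozel1989_strongLifting_archimedean)
    (hBC : ArthurClozel1989_strongLifting_cuspidal)
    (hn : 1 < n) (hKn : Module.finrank ℚ K = 1 → 2 < n) (hK : IsTotallyReal K ∨ IsCMField K)
    (π : CuspidalAutomorphicRepData n K hcpt) (hπ : π.1.IsRegularAlgebraic) (ι : PadicAlgCl ℓ ≃+* ℂ)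
    (E : HeightOneSpectrum (𝓞 K) → Multiset (PadicAlgCl ℓ))
    (hE : ∀ (v : HeightOneSpectrum (𝓞 K)) (α : Multiset ℂ), π.1.HasSatakeParamAt v α →
      ((E v).map fun a ↦ X - C a).prod = arithFrobPolyOfSatake ι v.residueCard n α)
    {B : Set ℕ}
    (hB : ∀ D : ℕ, D.Prime → D ∉ B → ∀ v : HeightOneSpectrum (𝓞 K), ((D : ℕ) : 𝓞 K) ∈ v.asIdeal →
      Algebra.IsUnramifiedAt ℤ v.asIdeal ∧ π.1.IsUnramifiedAt v)
    (i : GoodPrime K (8 * ℓ) B) :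
    ∃ (P : CuspidalAutomorphicRepData n (sqrtNegField K i.1)
        (isCompact_glFiniteIntegralLevel_holds n (sqrtNegField K i.1)))
      (ρ : FramedGaloisRep (sqrtNegField K i.1) (PadicAlgCl ℓ) n),
      IsUnramifiedBaseChangeLift π.1 P.1 ∧ ρ.toGaloisRep.IsSemisimple ∧ CompatibleAE E ρ ∧
      ∀ q : ℕ, q.Prime → q ≠ ℓ → 8 * q ∣ i.1 + 1 →
        (∀ w : HeightOneSpectrum (𝓞 (sqrtNegField K i.1)),
            ((q : ℕ) : 𝓞 (sqrtNegField K i.1)) ∈ w.asIdeal → IsGaloisCompatibleAt P.1 ι ρ w) ∧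
        ∀ v : HeightOneSpectrum (𝓞 K), ((q : ℕ) : 𝓞 K) ∈ v.asIdeal →
          ∀ w : HeightOneSpectrum (𝓞 (sqrtNegField K i.1)), w.asIdeal.under (𝓞 K) = v.asIdeal →
            ∀ α : Multiset ℂ, π.1.HasSatakeParamAt v α → P.1.HasSatakeParamAt w α := by
  classical
  have hℓ : ℓ.Prime := Fact.out
  have hD : i.1.Prime := i.2.1
  have hD0 : i.1 ≠ 0 := i.ne_zero
  have hDℓ : 8 * ℓ ∣ i.1 + 1 := i.2.2.1
  -- the member field `L = K(√-D)` and its level structure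
  set hL : isCompact_glFiniteIntegralLevel n (sqrtNegField K i.1) :=
    isCompact_glFiniteIntegralLevel_holds n (sqrtNegField K i.1)
  have hl2 : (Module.finrank K (sqrtNegField K i.1)).Prime := by
    rw [finrank_sqrtNegField]; exact Nat.prime_two
  -- a ramified place above `D` at which `π` is unramified
  obtain ⟨v₀, hv₀⟩ := exists_heightOneSpectrum_natCast_mem K hD
  obtain ⟨hunrZ, hπv₀⟩ := hB i.1 hD i.2.2.2.1 v₀ hv₀
  have hram : ¬ Algebra.IsUnramifiedIn (𝓞 (sqrtNegField K i.1)) v₀.asIdeal :=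
    not_isUnramifiedIn_sqrtNegField v₀ (intValuation_natCast_eq_of_isUnramifiedAt hD v₀ hv₀ hunrZ)
  -- the strong base change `Π = π_D`, cuspidal and regular algebraic
  obtain ⟨P, hP⟩ := hBC n K (sqrtNegField K i.1) hl2 hcpt π ⟨v₀, hram, hπv₀⟩ hL
  have hPra : P.1.IsRegularAlgebraic := hP.isRegularAlgebraic harch hl2 hπ
  -- `L` is CM and contains `ℚ(√-D)`, in which `ℓ` and every `q` with `8q ∣ D+1` split
  have hCM : IsCMField (sqrtNegField K i.1) := i.isCMField hK
  obtain ⟨F₀, hF₀, hF₀split⟩ :=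
    exists_intermediateField_hasTwoPrimesOver (K := K) (D := i.1) hD0
  -- "if `F⁺ = ℚ`, assume `n > 2`": `[L : ℚ] = 2 [K : ℚ]` is `2` only for `K = ℚ`
  have hLn : Module.finrank ℚ (sqrtNegField K i.1) = 2 → 2 < n := by
    intro h2
    apply hKn
    have hmul := Module.finrank_mul_finrank ℚ K (sqrtNegField K i.1)
    rw [finrank_sqrtNegField, h2] at hmul
    omega
  -- Thm. 9.2 for `Π`
  obtain ⟨ρ, hρss, h92ρ⟩ := h92 hL ℓ hn hCM F₀ hF₀ (hF₀split ℓ hℓ hDℓ) hLn P hPra ι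
  refine ⟨P, ρ, hP, hρss, ?_, ?_⟩
  · -- (i) compatibility almost everywhere with the datum of `π` (second alternative)
    have hgood := (finite_setOf_not_exists_goodPrime P.1 P.1.hasSatakeParamAt_cofinite_holds ℓ
      hℓ).compl_mem_cofinite
    have hunrK : ∀ᶠ v : HeightOneSpectrum (𝓞 K) in cofinite,
        Algebra.IsUnramifiedIn (𝓞 (sqrtNegField K i.1)) v.asIdeal := by
      filter_upwards [(GaloisRepresentations.finite_setOf_not_isUnramifiedIn K
        (sqrtNegField K i.1)).compl_mem_cofinite] with v hv
      simpa using hv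
    have hπunr : ∀ᶠ v : HeightOneSpectrum (𝓞 K) in cofinite, π.1.IsUnramifiedAt v :=
      π.1.hasSatakeParamAt_cofinite_holds
    show ∀ᶠ w : HeightOneSpectrum (𝓞 (sqrtNegField K i.1)) in cofinite, _
    filter_upwards [hgood, eventually_under (E := sqrtNegField K i.1) hunrK,
      eventually_under (E := sqrtNegField K i.1) hπunr] with w hw hwunr hwπ
    simp only [Set.mem_compl_iff, Set.mem_setOf_eq, not_not] at hw
    obtain ⟨q, hq, hqℓ, hqunr, hPq, hqw⟩ := hw
    obtain ⟨α, hα⟩ := hwπ (w.under (𝓞 K)) rfl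
    have hβ := hP w (w.under (𝓞 K)) α rfl (hwunr _ rfl) hα
    obtain ⟨hunr_w, hch⟩ := h92ρ q hq hqℓ (Or.inr ⟨hqunr, hPq⟩) w hqw _ hβ
    refine ⟨hunr_w, ?_⟩
    rw [GaloisRepresentations.residueCard_eq_residueCard_pow_inertiaDeg (v := w.under (𝓞 K)) (w := w)
      rfl, arithFrobPolyOfSatake_pow] at hch
    have hroots : E (w.under (𝓞 K)) =
        (arithFrobPolyOfSatake ι (w.under (𝓞 K)).residueCard n α).roots := by
      rw [← hE _ α hα, Polynomial.roots_multiset_prod_X_sub_C]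
    rw [frobPoly_eq_prod_map_pow, hroots]
    exact hch
  · -- (ii) at the places over a rational prime `q` with `8q ∣ D + 1` (first alternative)
    intro q hq hqℓ hqD
    refine ⟨fun w hqw ↦ h92ρ q hq hqℓ (Or.inl (hF₀split q hq hqD)) w hqw, ?_⟩
    intro v hqv w hwv α hα
    have hsplit : (v.asIdeal.primesOver (𝓞 (sqrtNegField K i.1))).ncard =
        Module.finrank K (sqrtNegField K i.1) := by
      rw [finrank_sqrtNegField]
      exact ncard_primesOver_sqrtNegField_eq_two v hq hqv hqD
    have hunr : Algebra.IsUnramifiedIn (𝓞 (sqrtNegField K i.1)) v.asIdeal :=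
      isUnramifiedIn_of_ncard_eq_finrank v hsplit
    have hf : w.asIdeal.inertiaDeg (𝓞 K) = 1 := inertiaDeg_eq_one_of_ncard_eq_finrank v hsplit w hwv
    have h := hP w v α hwv hunr hα
    rw [hf] at h
    simpa using h

/-! ### §3. The ranks `0` and `1`, unconditionally -/

/-- **`corollary93_unramified` in rank `0`** (degenerate): a `0 × 0` matrix representation is
unramified everywhere with characteristic polynomial `1 = arithFrobPolyOfSatake ı q 0 ∅` (a Satake
parameter on `GL_0` is empty). [folklore] -/
theorem corollary93_unramified_rank_zero {K : Type} [Field K] [NumberField K]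
    {hcpt : isCompact_glFiniteIntegralLevel 0 K} (π : CuspidalAutomorphicRepData 0 K hcpt)
    (ι : PadicAlgCl ℓ ≃+* ℂ) (r : FramedGaloisRep K (PadicAlgCl ℓ) 0) (v : HeightOneSpectrum (𝓞 K)) :
    IsGaloisCompatibleAt π.1 ι r v := by
  intro α hα
  have hα0 : α = 0 := Multiset.card_eq_zero.mp hα.card_eq
  subst hα0
  refine ⟨fun 𝔓 _ σ _ ↦ Subsingleton.elim _ _, fun 𝔓 _ σ _ ↦ ?_⟩
  simp [FramedRep.charpoly, arithFrobPolyOfSatake, Matrix.charpoly, Matrix.det_isEmpty]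

/-- **`corollary93_unramified` in rank `1`, unconditionally** (Weil 1956, "the case `n = 1` is
well known"): the `ℓ`-adic character `r₀` of the algebraic Hecke character `χ_π` of `π`
(`HeckeCharacter.IsAlgebraic.exists_lAdic`) is compatible with `π` at **every** place `v ∤ ℓ` at
which `π` is unramified (the proof of `theoremA_existence_rank_one` never uses the hypothesis "`π`
unramified above `q`"); any continuous semisimple HLTT-compatible `r` is isomorphic to `r₀`
(`theoremA_uniqueness_holds`), and compatibility is an isomorphism invariant
(`IsGaloisCompatibleAt.of_equiv`).  [cite: Weil1956, §1–§2]
[cite: HarrisLanTaylorThorneRMS2016, Thm. A (p. 3), proof of Thm. 7.13 (p. 232, case n = 1)] -/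
theorem corollary93_unramified_rank_one {K : Type} [Field K] [NumberField K]
    (hcpt : isCompact_glFiniteIntegralLevel 1 K) (hK : IsTotallyReal K ∨ IsCMField K)
    (π : CuspidalAutomorphicRepData 1 K hcpt) (hπ : π.1.IsRegularAlgebraic) (ι : PadicAlgCl ℓ ≃+* ℂ)
    (r : FramedGaloisRep K (PadicAlgCl ℓ) 1) (hrss : r.toGaloisRep.IsSemisimple)
    (hc : IsCompatible π.1 ι r) (v : HeightOneSpectrum (𝓞 K)) (hvℓ : ((ℓ : ℕ) : 𝓞 K) ∉ v.asIdeal) :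
    IsGaloisCompatibleAt π.1 ι r v := by
  classical
  -- Weil's character `r₀`, compatible at every `v ∤ ℓ`
  obtain ⟨χ, hχ⟩ := π.1.exists_heckeCharacter_glOne
  have halg : χ.IsAlgebraic :=
    π.1.isAlgebraic_heckeCharacter_glOne_of_isCAlgebraic hχ hπ.isCAlgebraic
  obtain ⟨r₀, hr₀⟩ := halg.exists_lAdic ι
  have hc₀ : ∀ u : HeightOneSpectrum (𝓞 K), ((ℓ : ℕ) : 𝓞 K) ∉ u.asIdeal →
      IsGaloisCompatibleAt π.1 ι r₀ u := by
    intro u huℓ α hα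
    have hur : χ.IsUnramifiedAt u := π.1.isUnramifiedAt_heckeCharacter_glOne hχ hα
    obtain ⟨hunr, hfrob⟩ := hr₀ u huℓ hur
    refine ⟨hunr, ?_⟩
    obtain ⟨ϖ, hϖ, rfl⟩ := π.1.exists_eq_singleton_of_hasSatakeParamAt_glOne hχ hα
    have hcu : ((χ (localUnits u ϖ) : ℂˣ) : ℂ) = χ.valueAtUniformizer u := by
      rw [← HeckeCharacter.localComponent_eq_valueAtUniformizer hur hϖ,
        HeckeCharacter.localComponent_apply]
    rw [arithFrobPolyOfSatake_one, Multiset.map_singleton, Multiset.prod_singleton, hcu]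
    exact hfrob
  -- `r ≅ r₀` by the uniqueness clause of Thm. A
  obtain ⟨e⟩ := theoremA_uniqueness_holds hcpt hK π hπ ℓ ι r₀ r
    (FramedRep.isSemisimple_of_rank_one r₀) hrss (isCompatible_of_forall_not_mem hc₀) hc
  exact (hc₀ v hvℓ).of_equiv e

/-! ### §4. Cor. 9.3 (unramified places) from Thm. 9.2 and the Arthur–Clozel leaves -/

/-- **Varma 2024, Cor. 9.3 at the unramified places (`corollary93_unramified`) from Thm. 9.2 and
quadratic base change — the printed "Theorem 9.2 in conjunction with Lemma 1 of [So] using the same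
argument as in Theorem VII.1.9 of [HT]", proved.**  Granted (1) Varma's Thm. 9.2 in the tree's
unramified-place vocabulary (raw hypothesis `h92`: for `K` CM containing an imaginary quadratic `F₀`
in which `p` splits, `n ≥ 2` and `n > 2` if `[K:ℚ] = 2`, `π` cuspidal regular algebraic, there is
a continuous semisimple `r` compatible with `π` at every place over a rational prime `q ≠ p` which
either splits in `F₀` — no condition on `π` above `q` — or above which `K` and `π` are unramified),
(2) the archimedean clause and (3) the strong cuspidal base change in prime degree of Arthur–Clozel
(`ArthurClozel1989_strongLifting_archimedean`, `ArthurClozel1989_strongLifting_cuspidal`), every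
continuous semisimple `r : Γ_K → GL_n(ℚ̄_ℓ)` with Harris–Lan–Taylor–Thorne's property
(`IsCompatible π ı r`), `K` totally real or CM, is compatible with `π` at **every** `v ∤ ℓ`.
Proof.  Ranks `0`, `1`: `corollary93_unramified_rank_zero/one`.  Rank `n ≥ 2`, `v ∣ q` with `π_v`
unramified: if `π` is unramified above `q`, HLTT-compatibility answers; otherwise `K` has two places
over `q`, so `[K : ℚ] ≥ 2` (`ncard_primesOver_span_le_finrank`); choose `D ∈ GoodPrime K (8ℓ) B` with
`8q ∣ D + 1` in which `v` splits completely (`GoodPrime.exists_dvd_split`), let `π_D`, `ρ_D` be as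
in `exists_rep_member_of_theorem92`; `r|_{Γ_{K_D}}` and `ρ_D` are both compatible almost everywhere
with the datum of `π` (`compatibleAE_restrictField_of_isCompatible`), hence isomorphic
(`CompatibleAE.nonempty_equiv`: Chebotarev, Brauer–Nesbitt); so `r|_{Γ_{K_D}}` is compatible with
`π_D` at the places over `v` (`IsGaloisCompatibleAt.of_equiv`), and this descends to `r` at the
completely split `v` (`isGaloisCompatibleAt_of_restrictField`).
[cite: VarmaFMS2024, Cor. 9.3 (p. 32) and its proof; Thm. 9.2 (pp. 30–31)]
[cite: HarrisTaylorAMS2001, proof of Thm. VII.1.9 (pp. 229–232)] -/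
theorem corollary93_unramified_of_theorem92
    (h92 : ∀ {n : ℕ} {K : Type} [Field K] [NumberField K]
      (hcpt : isCompact_glFiniteIntegralLevel n K) (p : ℕ) [Fact p.Prime], 1 < n → IsCMField K →
      ∀ (F₀ : IntermediateField ℚ K), Module.finrank ℚ F₀ = 2 ∧ IsTotallyComplex F₀ →
      HasTwoPrimesOver F₀ p → (Module.finrank ℚ K = 2 → 2 < n) →
      ∀ (π : CuspidalAutomorphicRepData n K hcpt), π.1.IsRegularAlgebraic →
      ∀ (ι : PadicAlgCl p ≃+* ℂ),
      ∃ r : FramedGaloisRep K (PadicAlgCl p) n, r.toGaloisRep.IsSemisimple ∧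
        ∀ q : ℕ, q.Prime → q ≠ p →
          (HasTwoPrimesOver F₀ q ∨
            (Algebra.IsUnramifiedIn (𝓞 K) (Ideal.span {(q : ℤ)}) ∧ π.1.IsUnramifiedAbove q)) →
          ∀ v : HeightOneSpectrum (𝓞 K), ((q : ℕ) : 𝓞 K) ∈ v.asIdeal →
            IsGaloisCompatibleAt π.1 ι r v)
    (harch : ArthurClozel1989_strongLifting_archimedean)
    (hBC : ArthurClozel1989_strongLifting_cuspidal) : corollary93_unramified := by
  intro n K _ _ hcpt hK π hπ ℓ _ ι r hrss hc v hvℓ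
  classical
  have hℓ : ℓ.Prime := Fact.out
  -- ranks `0` and `1`
  rcases Nat.lt_trichotomy n 1 with hn | rfl | hn
  · obtain rfl : n = 0 := Nat.lt_one_iff.mp hn
    exact corollary93_unramified_rank_zero π ι r v
  · exact corollary93_unramified_rank_one hcpt hK π hπ ι r hrss hc v hvℓ
  -- rank `n ≥ 2`; we may assume `π` unramified at `v`
  by_cases hπv : π.1.IsUnramifiedAt v
  swap
  · intro α hα
    exact absurd ⟨α, hα⟩ hπv
  obtain ⟨α, hα⟩ := hπv
  -- the rational prime `q` below `v`
  obtain ⟨q, hq, hqv⟩ := exists_natPrime_natCast_mem v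
  have hqℓ : q ≠ ℓ := by
    rintro rfl
    exact hvℓ hqv
  -- if `π` is unramified above `q`, HLTT-compatibility answers
  by_cases hπq : π.1.IsUnramifiedAbove q
  · exact hc q hq hqℓ hπq v hqv
  -- otherwise `K` has two places over `q`, so `[K : ℚ] ≥ 2`
  have hK1 : Module.finrank ℚ K = 1 → 2 < n := by
    intro h1
    exfalso
    simp only [AutomorphicRepData.IsUnramifiedAbove, not_forall, exists_prop] at hπq
    obtain ⟨w, hqw, hw⟩ := hπq
    have hne : v ≠ w := by
      rintro rfl
      exact hw ⟨α, hα⟩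
    have h2 : HasTwoPrimesOver K q := ⟨v, w, hne, hqv, hqw⟩
    rw [hasTwoPrimesOver_iff_one_lt_ncard K hq] at h2
    have h3 := ncard_primesOver_span_le_finrank (F₀ := K) hq
    omega
  -- the finite set `B` of bad rational primes
  choose f hf using fun w : HeightOneSpectrum (𝓞 K) ↦ exists_natPrime_natCast_mem w
  have hR : {w : HeightOneSpectrum (𝓞 K) | ¬ Algebra.IsUnramifiedAt ℤ w.asIdeal}.Finite := by
    refine (Ideal.finite_factors (differentIdeal_ne_bot (A := ℤ) (B := 𝓞 K))).subset
      fun w hw ↦ ?_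
    simp only [Set.mem_setOf_eq] at hw ⊢
    by_contra hdvd
    exact hw ((not_dvd_differentIdeal_iff (A := ℤ)).mp hdvd)
  have hcof : {w : HeightOneSpectrum (𝓞 K) | ¬ π.1.IsUnramifiedAt w}.Finite :=
    π.1.hasSatakeParamAt_cofinite_holds
  set B : Set ℕ := f '' ({w | ¬ Algebra.IsUnramifiedAt ℤ w.asIdeal} ∪ {w | ¬ π.1.IsUnramifiedAt w})
    with hBdef
  have hBfin : B.Finite := (hR.union hcof).image f
  have hB : ∀ D : ℕ, D.Prime → D ∉ B → ∀ v : HeightOneSpectrum (𝓞 K),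
      ((D : ℕ) : 𝓞 K) ∈ v.asIdeal → Algebra.IsUnramifiedAt ℤ v.asIdeal ∧ π.1.IsUnramifiedAt v := by
    intro D hD hDB v hv
    have hfv : f v = D := natPrime_eq_of_natCast_mem (hf v).1 hD (hf v).2 hv
    by_contra h
    rw [not_and_or] at h
    exact hDB ⟨v, by simpa [Set.mem_union, Set.mem_setOf_eq] using h, hfv⟩
  have hm : 8 * ℓ ≠ 0 := mul_ne_zero (by norm_num) hℓ.ne_zero
  -- a member `L = K(√-D)` with `8q ∣ D + 1` in which `v` splits completely
  obtain ⟨i, hqi, hsplit⟩ := GoodPrime.exists_dvd_split K (8 * ℓ) B hm hBfin v (8 * q)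
    (mul_ne_zero (by norm_num) hq.ne_zero)
  -- the Frobenius datum of `π` and the representation of the member
  obtain ⟨E, hE⟩ := exists_frobDatum π.1 ι
  obtain ⟨P, ρ, hP, hρss, hρc, hρT⟩ :=
    exists_rep_member_of_theorem92 h92 harch hBC hn hK1 hK π hπ ι E hE hB i
  obtain ⟨hρw, hPw⟩ := hρT q hq hqℓ hqi
  -- `ρ ≅ r|_{Γ_L}`: both are compatible almost everywhere with the datum of `π`
  have hrc : CompatibleAE E (r.restrictField (sqrtNegField K i.1)) :=
    compatibleAE_restrictField_of_isCompatible π.1 ι r hc E hE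
  obtain ⟨e⟩ := hρc.nonempty_equiv hρss
    (r.isSemisimple_restrictField (M := sqrtNegField K i.1) hrss) hrc
  -- descend at the completely split `v`
  obtain ⟨he, hf⟩ := ramificationIdxIn_eq_one_of_ncard_eq_finrank v hsplit
  refine isGaloisCompatibleAt_of_restrictField π.1 P.1 ι r he hf hα
    (fun w hwv ↦ hPw v hqv w hwv α hα) (fun w hwv ↦ ?_)
  have hqw : ((q : ℕ) : 𝓞 (sqrtNegField K i.1)) ∈ w.asIdeal := by
    rw [natCast_mem_iff_natCast_mem_under (K := K) w q]
    change ((q : ℕ) : 𝓞 K) ∈ w.asIdeal.under (𝓞 K)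
    rw [hwv]
    exact hqv
  exact (hρw w hqw).of_equiv e

/-! ### §5. Consequences: Thm. 1 (trace form) and lang.S27 -/

/-- **Varma's Thm. 1 at the unramified places in trace form (`theorem1_unramified_traces`) from
Thm. 9.2 and the Arthur–Clozel leaves**: `corollary93_unramified_of_theorem92` followed by
`theorem1_unramified_traces_of_corollary93_unramified`.
[cite: VarmaFMS2024, Thm. 1 (p. 2), Thm. 9.2 (pp. 30–31), Cor. 9.3 (p. 32)] -/
theorem theorem1_unramified_traces_of_theorem92
    (h92 : ∀ {n : ℕ} {K : Type} [Field K] [NumberField K]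
      (hcpt : isCompact_glFiniteIntegralLevel n K) (p : ℕ) [Fact p.Prime], 1 < n → IsCMField K →
      ∀ (F₀ : IntermediateField ℚ K), Module.finrank ℚ F₀ = 2 ∧ IsTotallyComplex F₀ →
      HasTwoPrimesOver F₀ p → (Module.finrank ℚ K = 2 → 2 < n) →
      ∀ (π : CuspidalAutomorphicRepData n K hcpt), π.1.IsRegularAlgebraic →
      ∀ (ι : PadicAlgCl p ≃+* ℂ),
      ∃ r : FramedGaloisRep K (PadicAlgCl p) n, r.toGaloisRep.IsSemisimple ∧
        ∀ q : ℕ, q.Prime → q ≠ p →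
          (HasTwoPrimesOver F₀ q ∨
            (Algebra.IsUnramifiedIn (𝓞 K) (Ideal.span {(q : ℤ)}) ∧ π.1.IsUnramifiedAbove q)) →
          ∀ v : HeightOneSpectrum (𝓞 K), ((q : ℕ) : 𝓞 K) ∈ v.asIdeal →
            IsGaloisCompatibleAt π.1 ι r v)
    (harch : ArthurClozel1989_strongLifting_archimedean)
    (hBC : ArthurClozel1989_strongLifting_cuspidal) : theorem1_unramified_traces :=
  theorem1_unramified_traces_of_corollary93_unramified
    (corollary93_unramified_of_theorem92 h92 harch hBC)

/-- **Varma's Thm. 1 at the unramified places in trace form from lang.S27 alone** (library-first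
form of the reduction).  lang.S27 (`exists_galoisRep_of_regularAlgebraic`: Harris–Lan–Taylor–Thorne's
Thm. A with Varma's Cor. 9.3 built in, i.e. compatibility at EVERY `v ∤ ℓ`) gives
`corollary93_unramified` by the uniqueness clause of Thm. A, proved in the tree from the Chebotarev
density theorem and Brauer–Nesbitt (`corollary93_unramified_of_regularAlgebraic`,
`ReciprocityGLnUniquenessHolds`), and then the trace statement
(`theorem1_unramified_traces_of_corollary93_unramified`, `VarmaUnramifiedWeilTracesProofs`).  So the
named fact `theorem1_unramified_traces` is also the one-liner
`theorem1_unramified_traces_of_regularAlgebraic exists_galoisRep_of_regularAlgebraic_holds` the day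
the summit crux lang.S27 is discharged; conversely nothing in the tree short of Varma's Thm. 9.2
(the raw hypothesis `h92` above) discharges either.
[cite: VarmaFMS2024, Thm. 1 (p. 2), Cor. 9.3 (p. 32)]
[cite: HarrisLanTaylorThorneRMS2016, Thm. A (p. 3), uniqueness clause] -/
theorem theorem1_unramified_traces_of_regularAlgebraic (hS : exists_galoisRep_of_regularAlgebraic) :
    theorem1_unramified_traces :=
  theorem1_unramified_traces_of_corollary93_unramified (corollary93_unramified_of_regularAlgebraic hS)

end Varma2024

/-- **lang.S27 (`exists_galoisRep_of_regularAlgebraic`) from four printed leaves**: Harris–Lan–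
Taylor–Thorne's Cor. 6.27 (`corollary627_splitOrUnramified`), Arthur–Clozel's archimedean clause and
strong cuspidal base change (`ArthurClozel1989_strongLifting_archimedean`,
`ArthurClozel1989_strongLifting_cuspidal`) — giving Thm. A, existence
(`theoremA_existence_of_namedLeaves`) — and Varma's Thm. 9.2 (raw hypothesis `h92`), which with the
same two Arthur–Clozel leaves gives Cor. 9.3 (`Varma2024.corollary93_unramified_of_theorem92`);
assembled by `exists_galoisRep_of_regularAlgebraic_of`.
[cite: HarrisLanTaylorThorneRMS2016, Thm. A (p. 3)] [cite: VarmaFMS2024, Thm. 9.2 and Cor. 9.3] -/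
theorem exists_galoisRep_of_regularAlgebraic_of_theorem92
    (h627 : HarrisLanTaylorThorne2016.corollary627_splitOrUnramified)
    (harch : ArthurClozel1989_strongLifting_archimedean)
    (hBC : ArthurClozel1989_strongLifting_cuspidal)
    (h92 : ∀ {n : ℕ} {K : Type} [Field K] [NumberField K]
      (hcpt : isCompact_glFiniteIntegralLevel n K) (p : ℕ) [Fact p.Prime], 1 < n → IsCMField K →
      ∀ (F₀ : IntermediateField ℚ K), Module.finrank ℚ F₀ = 2 ∧ IsTotallyComplex F₀ →
      HasTwoPrimesOver F₀ p → (Module.finrank ℚ K = 2 → 2 < n) →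
      ∀ (π : CuspidalAutomorphicRepData n K hcpt), π.1.IsRegularAlgebraic →
      ∀ (ι : PadicAlgCl p ≃+* ℂ),
      ∃ r : FramedGaloisRep K (PadicAlgCl p) n, r.toGaloisRep.IsSemisimple ∧
        ∀ q : ℕ, q.Prime → q ≠ p →
          (HasTwoPrimesOver F₀ q ∨
            (Algebra.IsUnramifiedIn (𝓞 K) (Ideal.span {(q : ℤ)}) ∧ π.1.IsUnramifiedAbove q)) →
          ∀ v : HeightOneSpectrum (𝓞 K), ((q : ℕ) : 𝓞 K) ∈ v.asIdeal →
            IsGaloisCompatibleAt π.1 ι r v) :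
    exists_galoisRep_of_regularAlgebraic :=
  exists_galoisRep_of_regularAlgebraic_of
    (HarrisLanTaylorThorne2016.theoremA_existence_of_namedLeaves h627 harch hBC)
    (Varma2024.corollary93_unramified_of_theorem92 h92 harch hBC)

end Literature.NumberTheory.Automorphic

end
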